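import Literature.NumberTheory.EllipticCurves.Rank1Residual.PrintShapeTorsion
import Literature.NumberTheory.EllipticCurves.Rank1Residual.Predicates
import HarnessLib

/-!
# Castella–Grossi–Skinner 2025, Theorem D: the `p`-part of the BSD formula in analytic rank `≤ 1` at a NON-ANOMALOUS Eisenstein prime `p > 2` of good reduction

HONEST FRAMING (cell `b2b-bsdres`, run/shared/lean/b2b/bsd-rank1-residual/; page 1 everywhere):
prove what is provable now; shrink each hard class to its core with data; no claim beyond stated
classes. The cell deletes the COMBINATION-SHAPED residual classes of the BSD formula in analytic
rank `≤ 1` from PUBLISHED theorems only and TYPES the construction-shaped ones; this is not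
"finishing BSD". This file vendors ONE published theorem as a named fact (`def … : Prop`, nothing
asserted; D-0014), with its hypotheses spelled by the cell's predicate file
`Rank1Residual/Predicates.lean` (= `bsdN/HYPOTHESES.md`), and proves its bookkeeping consequence
`BSD(E,p)` (Miller) through the cell's bridge `Rank1Residual/PrintShapeTorsion.lean`. It is the
named fact behind census row `T-CGS` / covered class C6 of RESIDUAL-CASES §a.1, and it is the
published theorem whose EXCLUDED case is exactly residual class X1 (`Rank1Residual.ClassX1`:
`anom(p)`). Registry: HOME/CITED-FACTS.md row C1 → §A (harvest seat `b2b-bsdres-harvest-2`).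

## Citation header (read by this seat)

* Authors: Francesc Castella, Giada Grossi, Christopher Skinner.
* Title: *Mazur's main conjecture at Eisenstein primes*.
* Venue: Math. Ann. **393** (2025), no. 2, 2451–2506, doi:10.1007/s00208-025-03239-x
  (Crossref record; bib key `CastellaGrossiSkinner2025`) = arXiv:2303.04373v2 (source file
  `Mazur-paper_revised.tex`, e-print dated 2025-10-16; v2 comment "Final version, to appear in
  Math. Annalen"). REFEREED / PUBLISHED.
* Theorem: **Theorem D** (`\begin{thmintro}\label{thm:pBSD}`, the fourth `\Alph`-numbered intro
  environment: A = `thm:CYC` (Mazur's main conjecture), B = Perrin-Riou's Conjecture, C = `thm:AC`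
  (anticyclotomic main conjectures), D = `thm:pBSD`), printed in **§1.2** "Application to the
  `p`-part of the Birch–Swinnerton Dyer formula" of the Introduction (= §1) of the final version
  arXiv v2 = Math. Ann. (TeX lines 586–604), PDF p. 5; the store's text `paper:arxiv-2303.04373` is
  the arXiv **v1** TeX (LaTeXML), which numbers the Introduction §0 and renders the lettered theorems
  as "Theorem 1 … Theorem 4" — hence "§0.3" / "Thm. 4" in earlier cell files (RESIDUAL-CASES §a.1 C6,
  HYPOTHESES.md T-CGS, `Predicates.lean` `Anom`, `ClassX1.lean`): Thm. 4 / §0.3 there = Theorem D /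
  §1.2 here (same text). VERSION NOTE (cell bsd-uniform, seat ue-lit, 2026-08-22; see
  run/shared/lean/pub/bsd-uniform/ue/EISENSTEIN-AS-PRINTED.md §3.2): in the printed numbering all body
  sections are v1 + 1 — the Beilinson–Flach input of Theorem A is **Thm. 4.1.1** (v1: 3.1.1), whose
  printed proof reads "This is proved in [BSTW23, §5], where it is deduced from results in [KLZ17] in
  combination with results in [Betina–Dimitrov–Pozzi]", bbl entry [BSTW23] = A. Burungale, C. Skinner,
  Y. Tian, X. Wan, *Zeta elements for elliptic curves and applications*, preprint 2023
  (= arXiv:2409.01350) — the documentation flag `CGS25-BST-Thm311` of the b2b/pub cells names the v1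
  form "Thm. 3.1.1, proved in [BST] = Burungale–Skinner–Tian 2021" of the same preprint dependence;
  Theorems A (= Thm. 7.1.1), C (= Cor. 6.5.4) and D are identical in substance in v1 and v2. The
  journal pagination of Theorem D is not independently held (want acq-08184, cite-only).
  IN-CELL REFEREE of that preprint node (cell `bsd-litref` 2026-08-26; sheets cgs25-r1 cd6b303b333505a2
  (+ ADDENDUM-1 81b0ea39d50df0e4), cgs25-r2 ADDENDUM-1 5366702acfa5a3a4,
  cgs25-r2 0d093e8f7ab6b874, bstw24-r1 2ab68891cb7b08bc (+ addenda dd57a5d9 / 5fc2aa1c / f18da4da), bstw24-r2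
  69e4de3690fd21dc (+ addenda 850c38dd / 429d6b8a / 4e4fd1dd); referee C (pub-bsdpct-r3; family service completed there, deferred items to C4 = pub-bsdpct-r7) R381 (cgs25 group ruling) with
  referee C's R353 (ζ) / R361 (ε) (register-wide Ohta-ES@3 word + two-prong strike test), referee A R346):
  statement VERBATIM (both readers); `p ≥ 5` reader-PASS-in-cell at statement level (reader 2: for an
  auxiliary field with `p ∤ h_K`, BSTW v2 TeX l. 2711–2713 / Prop. 4.12 l. 3381–3386; reader 1 ADDENDUM-1:
  PR half PASS on all 276, Gr half PASS from print on the 76 with `a_p ≢ ±1 (mod p)` [KLZ17 Prop. 7.3.1],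
  RETURN(line BSTW l. 4175–4176) / PASS-with-cell-repair (Lemma W) on the 200 (anom); reader 2 ADDENDUM-1:
  PASS-in-cell on all 276 incl. `a_p ≡ −1` — l. 4175–4176 proved in cell at level N (§E) —, the ONLY cut
  being the auxiliary-field proviso; disagreement reported, desk arbitrates); `p = 3` GAP(line)
  (KLZ17 §7.2 «p ≥ 5»; BSTW Thm. 4.1 l. 2915 / Rem. 6.1 l. 4918–4922 ⇐ [SV-S–Ohta] unposted; node two-pronged
  G♭ ∧ G♯, both engaged by row D4) — details, F-Hp, the component string and the LIFT RULE in
  `MazurMainConjecture.lean` §In-cell referee. On the census the rank-one D4 classes are booked on the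
  BF-free twist row T-CGLS55-TW (referee A R346; Summits-side
  `Partition/MainConjecturesEisensteinTwistCertificate{,Keys}.lean`), the `p = 3` instances of Theorem D
  are re-derived Summits-side from the claim-tagged `p = 3` binder of Theorem A (p461118, p462807), and
  the 3 rank-zero `p ≥ 5` classes (316944bk1@5, 458643bi1@5, 486720hi1@7) from the sibling node
  `…_of_not_dvd_classNumber` (p465812) inside the prover's D4R0-TWOSTEP certificate (kernel p465061) — so that
  this binder is cited as reader-refereed only at `p ≥ 5`.
  UPDATE 2026-08-27 (C4 = pub-bsdpct-r7: C4-R3 00:54Z + C4-R3-ADD 01:02Z [bstw24 group], C4-R5 01:51Z [cgs25 residue];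
  referee A R418 01:40Z): §5 @ `p = 3` GAP(line) / @ `p ≥ 5` PASS-in-cell = VERDICTS OF RECORD; V2 of record «PASS-in-cell
  WITH READER REPAIRS on all 276 D4 classes at p ≥ 5, every admissible auxiliary field, no side condition» (Q1 / Prop. 4.12
  repaired ×2: Lemma S+T, Lemma C; BSTW l. 4175–4177 admitted ×3: Lemma W, D-ω, §E); A R418 STRUCK the 141 `p ≥ 5`
  register entries `CGS25-BST-Thm311@p` at tier PROVED = print-refereed PASS-in-cell (27 classes literal → PROVED, 114
  rider-held; `p = 3` entries untouched); @3 strike test of record = (i′) ∧ (ii) — details and the component string of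
  record in `MazurMainConjecture.lean` §In-cell referee UPDATE.
* Verbatim (TeX source lines 591–606; Theorem A = lines 382–392):

> **Theorem A.** Let `E/ℚ` be an elliptic curve, and let `p > 2` be a prime of good reduction for
> `E`. Suppose that `p` is Eisenstein with `φ|_{G_p} ≠ 1, ω`, where `G_p ⊂ G_ℚ` is a decomposition
> group at `p`. Then `𝔛_ord(E/ℚ_∞)` is `Λ_ℚ`-torsion with
> `ch_{Λ_ℚ}(𝔛_ord(E/ℚ_∞)) = (𝓛_p^{MSD}(E/ℚ))`, and hence Mazur's main conjecture holds.
>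
> **Theorem D.** Let `E/ℚ` and `p > 2` be as in Theorem A, and let `r ∈ {0,1}`. If
> `ord_{s=1} L(E,s) = r`, then
> `ord_p( L^{(r)}(E,1) / (Reg(E/ℚ) · Ω_E) ) = ord_p( #Ш(E/ℚ) ∏_{ℓ∤∞} c_ℓ(E/ℚ) )`,
> where `Reg(E/ℚ)` is the regulator of `E(ℚ)`, `Ω_E = ∫_{E(ℝ)} |ω_E|` is the Néron period
> associated to the Néron differential `ω_E`, and `c_ℓ(E/ℚ)` is the Tamagawa number of `E` at the
> prime `ℓ`. In other words, the `p`-part of the Birch–Swinnerton-Dyer formula for `E` holds.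

  with (§1, p. 3) "`p` is an Eisenstein prime for `E`, meaning that `E` admits a rational
  `p`-isogeny. Equivalently, … `E[p]` is reducible as a `Gal(ℚ̄/ℚ)`-module" and "the isogeny
  character `φ : G_ℚ → 𝔽_p^×`, i.e., the character describing the action of `G_ℚ` on the kernel
  `C ⊂ E[p]` of the underlying rational `p`-isogeny"; `ω` = the Teichmüller character. Printed proof
  (5 lines): `r = 0` as in [CGLS22, Thm. 5.1.4] with Greenberg–Vatsal replaced by Theorem A
  (Mazur's main conjecture) — i.e. MC + Greenberg's Euler-characteristic formula + Mazur–SwD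
  interpolation; `r = 1` as in [CGLS22, Thm. 5.3.1], choosing `K` with `L(E^K,1) ≠ 0` and applying
  the `r = 0` case to `E^K`. Remark after Thm. D: previously known (Greenberg–Vatsal 2000 in rank 0,
  Castella–Grossi–Lee–Skinner, Invent. Math. 227 (2022) Thm. F in rank 1) "for roughly half of the
  `p`-Eisenstein cases, as both results required a certain parity hypothesis on `φ`".

## Hypotheses, enumerated (word for word → cell predicate)

1. `E/ℚ` an elliptic curve — `W : WeierstrassCurve ℚ`, `[W.IsElliptic]`, globally minimal model
   (`[W.IsGloballyMinimal]`, needed for `a_p`).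
2. "`p > 2`" — `2 < p`. (No `p ≥ 5`; `p = 3` allowed.)
3. "a prime of good reduction for `E`" — `Good W p` (`p ∤ N`). Multiplicative and additive `p` are
   NOT covered (classes X2, X3).
4. "`p` is Eisenstein" = `E` admits a rational `p`-isogeny = `E[p]` reducible — `Red W p`.
5. "`φ|_{G_p} ≠ 1, ω`" — rendered `¬ Anom W p`, i.e. (given 3–4) `a_p ≢ 1 (mod p)`; this is the
   lane's decision procedure for the hypothesis (bsdN/HYPOTHESES.md row T-CGS; RESIDUAL-CASES §a.0
   `anom(p)`; `Predicates.lean` docstring of `Anom`). DICTIONARY (flag name for the referee: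
   `CGS25-anom-dictionary`, the analogue of `LLT24-Deuring-dictionary`): for `p > 2` of good
   reduction with `E[p]` reducible, the reduction is ordinary (a supersingular `E[p]|_{I_p}` is the
   irreducible level-2 fundamental character, Serre 1972 Prop. 12), so
   `E[p]^{ss}|_{G_p} = χ ⊕ ωχ^{-1}` with `χ` unramified and `χ(Frob_p) ≡` unit root `≡ a_p (mod p)`;
   `φ|_{G_p} ∈ {χ, ωχ^{-1}}`; since `ω|_{I_p} ≠ 1` for `p > 2`, `φ|_{G_p} = 1 ⟺ χ = 1` and
   `φ|_{G_p} = ω ⟺ χ = 1`; hence `φ|_{G_p} ∈ {1, ω} ⟺ χ = 1 ⟺ a_p ≡ 1 (mod p)`, for EITHER choice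
   of the isogeny character (`ψ = ωφ^{-1}` satisfies the same dichotomy). No image condition
   ((irr)/(surj)/(im)) — the theorem is ABOUT reducible `E[p]`; no (ram) prime; no conductor,
   semistability, CM or Tamagawa condition; no parity condition on `φ` (that was CGLS 2022 Thm. F /
   Greenberg–Vatsal 2000 (GV)).
6. "`r ∈ {0,1}`, `ord_{s=1} L(E,s) = r`" — `W.analyticRank ≤ 1`, `L^{(r)}(E,1) = W.leadingLCoeff`
   (`r! = 1`).
7. `#Ш(E/ℚ)` — `W.shaOrder` under the binder `Finite W.sha` (a theorem for `r ≤ 1`, Gross–Zagier–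
   Kolyvagin = bsd.S17 `rank_eq_analyticRank_of_analyticRank_le_one`, carried as a binder exactly as
   in the sibling facts `BurungaleCastellaSkinner2025.cor131_…`, `JetchevSkinnerWan2017.thm121_…`).
8. Torsion: the printed display has NO torsion term. Under hypotheses 2–5 this is consistent with
   BSD: a rational point of order `p` would make the trivial character a constituent of `E[p]`, so
   `{φ, ψ} = {1, ω}` and `φ|_{G_p} ∈ {1, ω}` — excluded; equivalently `E(ℚ)[p] ↪ Ẽ(𝔽_p)` for
   `p > 2` good forces `a_p ≡ 1 (mod p)`. The tree has no lemma "reducible ∧ non-anomalous ⇒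
   `p ∤ #E(ℚ)_tors`", so the consumer theorems below carry `p ∤ #E(ℚ)_tors` as an explicit,
   per-pair decidable binder `htors` (never a restriction in the theorem's scope, by the sentence
   above). Conclusion shape = CITED-FACTS shape (c) "quotient, no torsion", literally the BCS
   Cor. 1.3.1 display: `∃ q : ℚ, L^{(r)}(E,1)/(Ω_E·Reg) = q ∧ ord_p q = ord_p #Ш + ord_p ∏ c_ℓ`.

No `_holds` is to be expected soon (anticyclotomic Iwasawa theory, Beilinson–Flach classes, Hida's
`μ = 0`, Rubin's main conjecture: none in Mathlib); consumers take
`(h : thmD_padicValRat_bsd_rank_le_one)`. D-0026: this file introduces exactly ONE named fact (the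
published theorem) and proves its consumers; nothing else is minted.

## References
* [CastellaGrossiSkinner2025] F. Castella, G. Grossi, C. Skinner, *Mazur's main conjecture at
  Eisenstein primes*, Math. Ann. 393 (2025) 2451–2506 = arXiv:2303.04373v2, Theorems A, D (§1;
  Theorem D in §1.2; v1 numbering §0 / §0.3).
* F. Castella, G. Grossi, J. Lee, C. Skinner, *On the anticyclotomic Iwasawa theory of rational
  elliptic curves at Eisenstein primes*, Invent. Math. 227 (2022) 517–580 = arXiv:2008.02571,
  Thms. E, F, 5.1.4, 5.3.1 (the rank-one predecessor with the parity hypothesis).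
* R. Greenberg, V. Vatsal, Invent. Math. 142 (2000) Thm. 1.3 (tree `GreenbergVatsal2000`).
* bsdN/HYPOTHESES.md row T-CGS; RESIDUAL-CASES.md §a.0 `anom(p)`, §a.1 C6, §a.2 X1.
* R. L. Miller, LMS J. Comput. Math. 14 (2011) Def. 1.1 (`Miller2011LMS`) — `BSDp`.
-/

noncomputable section

open scoped Classical

open WeierstrassCurve Literature.NumberTheory.EllipticCurves
  Literature.NumberTheory.EllipticCurves.Rank1Residual

namespace Literature.NumberTheory.EllipticCurves.CastellaGrossiSkinner2025

/-- **Castella–Grossi–Skinner, Math. Ann. 393 (2025) 2451–2506 = arXiv:2303.04373v2, Theorem D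
(§1.2, p. 5 of arXiv v2 = the printed numbering; v1 / LaTeXML "§0.3, Theorem 4")**, with the
standing hypotheses of Theorem A: "Let
`E/ℚ` be an elliptic curve, and let `p > 2` be a prime of good reduction for `E`. Suppose that `p`
is Eisenstein [`E` admits a rational `p`-isogeny, i.e. `E[p]` is reducible] with `φ|_{G_p} ≠ 1, ω`
[`φ` the isogeny character, `ω` the Teichmüller character, `G_p` a decomposition group at `p`] …
and let `r ∈ {0,1}`. If `ord_{s=1} L(E,s) = r`, then
`ord_p(L^{(r)}(E,1)/(Reg(E/ℚ)·Ω_E)) = ord_p(#Ш(E/ℚ) ∏_{ℓ∤∞} c_ℓ(E/ℚ))` … In other words, the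
`p`-part of the Birch–Swinnerton-Dyer formula for `E` holds." Hypotheses in the cell's predicate
names (module docstring, items 1–8): `2 < p`, `Good W p`, `Red W p`, `¬ Anom W p` (= `φ|_{G_p} ∉
{1, ω}` by the ordinary-reduction dictionary `⟺ a_p ≢ 1 (mod p)`, bsdN/HYPOTHESES.md T-CGS),
`W.analyticRank ≤ 1`, `Finite W.sha` (binder, bsd.S17). No image, (ram), conductor, CM, parity or
Tamagawa hypothesis. Conclusion: `L^{(r)}(E,1)/(Ω_E·Reg)` is a rational `q` with
`ord_p q = ord_p #Ш + ord_p ∏ c_ℓ` (no torsion term, as printed). PUBLISHED (census row T-CGS,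
covered class C6; its excluded case `anom(p)` is residual class X1). REGISTER TIERS (in-cell referee
2026-08-26, module docstring; referee C (pub-bsdpct-r3; family service completed there, deferred items to C4 = pub-bsdpct-r7) R381 / A R346): `p ≥ 5` reader-PASS-in-cell (auxiliary field
with `p ∤ h_K`; since C4-R3 / C4-R5 2026-08-27: with reader repairs for every class, no side condition; referee A R418:
register entries at `p ≥ 5` struck, tier PROVED = print-refereed PASS-in-cell); `p = 3` GAP(line) — consumers at `3`
bind the claim-tagged Theorem-A-at-3 binder (p461118).
[cite: CastellaGrossiSkinner2025, Theorem D (§1.2; arXiv:2303.04373v2 p. 5) with Theorem A's hypotheses (§1 p. 3)] -/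
def thmD_padicValRat_bsd_rank_le_one : Prop :=
  ∀ (W : WeierstrassCurve ℚ) [W.IsElliptic] [W.IsGloballyMinimal] (p : ℕ) [Fact p.Prime],
    2 < p → Good W p → Red W p → ¬ Anom W p →
    W.analyticRank ≤ 1 → Finite W.sha →
    ∃ q : ℚ, W.leadingLCoeff / ((W.realPeriodRat * W.regulator : ℝ) : ℂ) = (q : ℂ) ∧
      padicValRat p q = (padicValNat p W.shaOrder : ℤ) + padicValNat p W.tamagawaProduct

variable {W : WeierstrassCurve ℚ} {p : ℕ} [Fact p.Prime]

/-- The hypothesis "`φ|_{G_p} ≠ 1, ω`" of Theorem A/D in the lane's decidable form: at an Eisenstein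
prime of good reduction, `¬ anom(p)` is literally `a_p ≢ 1 (mod p)` (unfolding `Rank1Residual.Anom`;
the Galois-theoretic dictionary is in the module docstring, item 5). [cite: CastellaGrossiSkinner2025, Theorem A (hypothesis on φ)] -/
theorem not_anom_iff_of_red_of_good [W.IsGloballyMinimal] (hred : Red W p) (hgood : Good W p) :
    ¬ Anom W p ↔ ¬ (p : ℤ) ∣ W.frobeniusTrace p - 1 := by
  unfold Anom
  exact ⟨fun h hdvd => h ⟨hred, hgood, hdvd⟩, fun h hA => h hA.2.2⟩

/-- **Theorem D ⇒ the general print shape `PPart`** at every pair in its scope, given the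
per-pair bit `p ∤ #E(ℚ)_tors` (automatic in print under the theorem's hypotheses — module docstring
item 8 — and decided by the census; carried as a binder because the tree has no lemma
"reducible ∧ non-anomalous ⇒ no rational `p`-torsion"). Bookkeeping: with `ord_p #E(ℚ)_tors = 0`
the no-torsion display IS the Yan–Zhu/Keller–Yin display `PPart W p`.
[cite: CastellaGrossiSkinner2025, Theorem D (display)] -/
theorem pPart_of_thmD [W.IsElliptic] [W.IsGloballyMinimal] (h : thmD_padicValRat_bsd_rank_le_one)
    (hp : 2 < p) (hgood : Good W p) (hred : Red W p) (hna : ¬ Anom W p)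
    (hr : W.analyticRank ≤ 1) (hfin : Finite W.sha) (htors : ¬ p ∣ W.torsionOrder) :
    PPart W p := by
  obtain ⟨q, hq, hv⟩ := h W p hp hgood hred hna hr hfin
  refine ⟨q, hq, ?_⟩
  rw [hv, padicValNat.eq_zero_of_not_dvd htors]
  simp

/-- **Theorem D ⇒ Miller's `BSD(E,p)`** for every `(E,p)` in its scope: `E/ℚ` with
`ord_{s=1} L(E,s) ≤ 1`, `p > 2` a good Eisenstein prime with `a_p ≢ 1 (mod p)` (`¬ anom(p)`), and
the census bit `p ∤ #E(ℚ)_tors` (automatic in print, item 8 of the module docstring). Finiteness of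
`Ш` is Gross–Zagier–Kolyvagin (`hGZK` = bsd.S17), modularity `hmod` feeds `L^{(r)}(E,1) ≠ 0`, and the
display becomes `BSDp W p` through the cell's bridge `Rank1Residual.bsdp_of_pPart`. This is census
row T-CGS / covered class C6 of RESIDUAL-CASES §a.1 as a tree implication; together with the X1
files it shows that at a good Eisenstein prime `p > 2` the rank-`≤ 1` residue is exactly `anom(p)`
(class X1). [cite: CastellaGrossiSkinner2025, Theorem D] [cite: Miller2011LMS, Def. 1.1] -/
theorem bsdp_of_thmD (h : thmD_padicValRat_bsd_rank_le_one) (hmod : hasEntireLFunction_rat)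
    (hGZK : rank_eq_analyticRank_of_analyticRank_le_one)
    (W : WeierstrassCurve ℚ) [W.IsElliptic] [W.IsGloballyMinimal] (p : ℕ) [Fact p.Prime]
    (hp : 2 < p) (hgood : Good W p) (hred : Red W p) (hna : ¬ Anom W p)
    (hr : W.analyticRank ≤ 1) (htors : ¬ p ∣ W.torsionOrder) : BSDp W p :=
  bsdp_of_pPart W p hmod hGZK hr
    (pPart_of_thmD h hp hgood hred hna hr (hGZK W hr).2 htors)

/-- The `a_p`-form of the class statement: `p > 2` good, `E[p]` reducible, `a_p ≢ 1 (mod p)`,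
`r_an ≤ 1`, `p ∤ #E(ℚ)_tors` ⇒ `BSD(E,p)` — the complement of `anom(p)` inside "good Eisenstein
`p > 2`", i.e. everything the residual class X1 leaves out is covered by Theorem D.
[cite: CastellaGrossiSkinner2025, Theorem D] -/
theorem bsdp_of_thmD_of_not_dvd (h : thmD_padicValRat_bsd_rank_le_one)
    (hmod : hasEntireLFunction_rat) (hGZK : rank_eq_analyticRank_of_analyticRank_le_one)
    (W : WeierstrassCurve ℚ) [W.IsElliptic] [W.IsGloballyMinimal] (p : ℕ) [Fact p.Prime]
    (hp : 2 < p) (hgood : Good W p) (hred : Red W p)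
    (hap : ¬ (p : ℤ) ∣ W.frobeniusTrace p - 1)
    (hr : W.analyticRank ≤ 1) (htors : ¬ p ∣ W.torsionOrder) : BSDp W p :=
  bsdp_of_thmD h hmod hGZK W p hp hgood hred
    ((not_anom_iff_of_red_of_good hred hgood).2 hap) hr htors

end Literature.NumberTheory.EllipticCurves.CastellaGrossiSkinner2025
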